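import Summits.BirchSwinnertonDyer.BirchSwinnertonDyer.Theorems.ErratumRoadFiveEulerHalfAlphaInert
import Literature.NumberTheory.EllipticCurves.Rank1Residual.Typed.KolyvaginCertificate
import Literature.NumberTheory.EllipticCurves.BSDQuadraticDescentShaOddPartGeneralProofs
import Literature.NumberTheory.EllipticCurves.BSDRootNumberSmallConductorProofs
import HarnessLib

/-!
# Crux `ShimuraKolyvaginOrderBoundInertFromFive` (item 19718): its conclusion at a datum from two
# CLASSICAL certificates — `Ш(E/ℚ)[p] = 0` and the rank-`0` twist's `p`-adic unit `L`-value

Cell `bsd-stepL` (run/shared/lean/pub/bsd-stepL/), seat `bsd-stepL-shim-p1` g5, route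
`route-BirchSwinnertonDyer-ErratumRoadFive` rev 18 (D6 inert re-key), crux item stmt-BirchSwinnertonDyer-19718
`ShimuraKolyvaginOrderBoundInertFromFive`: Kolyvagin's ORDER bound `#Ш(E/K)[p^∞] ≤ p^{2·ord_p[E(K):ℤP]}` for every
point `P ∈ E(K)` carrying the Cai–Shu–Tian display on the Shimura curve `X_{N⁺,N⁻}` with `p ∣ N⁻ = ∏S` (`p` INERT in
`K`, `5 ≤ p`, `ρ̄_{E,p}` onto). Printed statement Kim 2024 Thm. 4.3; no located printed proof at `p ∣ N⁻`.

HONEST FRAMING. Nothing here proves the slice. This file is the TOOL behind its plan-only BC5 rung (a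
"certificate row", planner g25 2026-08-26T13:53:43Z: "S ∋ p never empty ⇒ rung = certificate row"): at a datum
`(E, p, K, S)` of the slice where, in addition,

* (i) `Ш(E/ℚ)[p] = 0` — e.g. from Kolyvagin's CLASSICAL index certificate at an auxiliary Heegner field `K₁`
  (all primes of `N` split in `K₁`, `y_{K₁}` non-torsion, `p ∤ [E(K₁):ℤy_{K₁}]`; tree theorem
  `Typed.noPTorsion_of_kolyvagin_of_not_dvd_index` from the PUBLISHED facts `kolyvagin`,
  `Kolyvagin1990_padicValNat_card_sha_le`), and
* (ii) the rank-`0` twist `E^{d_K}` has `L(E^{d_K},1) ≠ 0` with `ord_p (L(E^{d_K},1)/Ω_{E^{d_K}}) ≤ 0` (an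
  ATTESTED analytic certificate: modular symbols / `ellanalyticrank`),
* and no Tamagawa number is lost inside `S` (`p ∤ ord_ℓ Δ_min(E)` for `ℓ ∈ S`, and at the split multiplicative
  primes outside `S`),

the conclusion of the slice holds for EVERY displayed `P` because **`Ш(E/K)[p^∞] = 0` outright**:
`Ш(E^{d_K}/ℚ)[p^∞] = 0` by Skinner 2016 Thm. C for the twist (multiplicative at the inert `p` —
`mult_twist_of_jacobiSym`; `E^{d_K}[p]` irreducible — `hasIrreducibleModPGaloisRep_twist_model`; the (ram) witness
transported; `p ∤ ∏c(E^{d_K})` by `padicValNat_tamagawaProduct_add_twist_le_of_inertSet'`; `p ∤ #E^{d_K}(ℚ)_tors`),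
and `#Ш(E/K)[p^∞] = #Ш(E/ℚ)[p^∞] · #Ш(E^{d_K}/ℚ)[p^∞]` for odd `p`
(`card_primaryComponent_sha_baseChange_quadratic_of_odd_of_finite`, JSW 2017 §7.4.1). So on such a datum the
slice is TRUE for the trivial reason `1 ≤ p^{2m}` — which is all a certificate row can show: on the kernel's
use-locus of the slice ((ram) ∧ (T2α), ¬(ram) ∧ `p ∣ ∏c`) one has `p ∣ ∏_ℓ c_ℓ(E)`, so `p ∣ [E(K₁):ℤy_{K₁}]` at
EVERY classical Heegner field (Gross–Zagier V.(2.2)) and certificate (i) cannot come from Kolyvagin's classical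
theorem there — that is exactly why the route needs the Shimura curve. THEOREMS ONLY (no `def`, no new fact, no
`sorry`); CONDITIONAL on the displayed published facts (`Skinner2016.thmC_padicValRat_bsd_rank_zero`,
`rank_eq_analyticRank_of_analyticRank_le_one`, `hasEntireLFunction_rat`; for §3 also `kolyvagin`,
`Kolyvagin1990_padicValNat_card_sha_le`) and on the certificates; nothing is booked; BSD is not proved by any of
this. The rung at the pair `(5015b1, 5)`, `d_K = −23`, `S = {5, 17}` is the sibling file
`ErratumRoadFiveShimuraKolyvaginOrderBoundInertRung5015b1.lean`.

PARTITION: X11b@p≥5 (B9 ∕ N8) × the p ∣ N⁻ Shimura–Kolyvagin slice (item 19718) — types-the-object-of (a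
certificate-row tool); closes: none (T7).

## Contents

* `natCard_primaryComponent_eq_one_of_noPTorsion` — `A[p] = 0 ⇒ #A[p^∞] = 1` (any abelian group).
* `natCard_primaryComponent_sha_twist_eq_one_of_certificate` — the twist side: `#Ш(E^{d_K}/ℚ)[p^∞] = 1` from
  Skinner's Thm. C + the attested unit `L`-value, on the slice's binders with no Tamagawa loss in `S`.
* `natCard_primaryComponent_sha_baseChange_eq_one_of_certificates` — `#Ш(E/K)[p^∞] = 1` from (i) + (ii).
* `shimuraKolyvaginOrderBoundInert_at_of_certificates` — the slice's conclusion (its trailing ∀-clause, verbatim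
  shape) at such a datum.
* `noPTorsion_sha_of_kolyvaginIndexCertificate` — supplier of (i) from the classical index certificate, in the
  `∀ N W K` currency of the route's `PublishedInputsFive`.

References: [Skinner2016PacificMC] Thm. C (§1); [JetchevSkinnerWan2017] §7.4.1–7.4.2 (pp. 30–31);
[McCallumLMS1991] §1 Theorem (Kolyvagin), p. 296; [GrossLMS1991] Prop. 2.1 (2), V-style index identity (2.2)
of [GrossZagier1986] V.§2; [Kim2022HigherGZ] §2.1, Thm. 4.3 (the slice's printed statement);
[SilvermanAEC2009] VII.5 Prop. 5.1, X.5 Cor. 5.4.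
-/

noncomputable section

open scoped Classical

open WeierstrassCurve NumberField IsDedekindDomain Literature.NumberTheory.EllipticCurves
  Rat.HeightOneSpectrum CongruenceSubgroup
  Literature.NumberTheory.EllipticCurves.ModularForms
  Literature.NumberTheory.EllipticCurves.Rank1Residual
  Literature.NumberTheory.EllipticCurves.Rank1Residual.Typed
  Literature.NumberTheory.QuadraticFields.Quadratic
  Summit.BirchSwinnertonDyer.Rank1Residual Summit.BirchSwinnertonDyer.Rank1Residual.X11b

-- the cell's Theorems namespace repeats the summit name (Summit.<Summit>.<Problem>), as in every sibling file
set_option linter.dupNamespace false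

namespace Summit.BirchSwinnertonDyer.BirchSwinnertonDyer.Theorems

/-! ### §1. A group without `p`-torsion has trivial `p`-primary component -/

/-- **`A[p] = 0 ⇒ #A[p^∞] = 1`** for an additive commutative group `A` (no finiteness assumed): if
`p^{n+1} x = 0` then `p^n x ∈ A[p] = 0`, so by induction every element of `A[p^∞]` vanishes. [folklore] -/
theorem natCard_primaryComponent_eq_one_of_noPTorsion {A : Type*} [AddCommGroup A] (p : ℕ) [Fact p.Prime]
    (h : ∀ x : A, (p : ℤ) • x = 0 → x = 0) :
    Nat.card (AddCommGroup.primaryComponent A p) = 1 := by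
  have key : ∀ n : ℕ, ∀ x : A, p ^ n • x = 0 → x = 0 := by
    intro n
    induction n with
    | zero => intro x hx; simpa using hx
    | succ n ih =>
      intro x hx
      rw [pow_succ', mul_smul] at hx
      exact ih x (h _ (by rwa [natCast_zsmul]))
  have hbot : AddCommGroup.primaryComponent A p = ⊥ := by
    refine (AddSubgroup.eq_bot_iff_forall _).mpr fun x hx ↦ ?_
    obtain ⟨n, hn⟩ := (AddCommGroup.mem_primaryComponent).1 hx
    exact key n x hn
  rw [hbot, AddSubgroup.card_bot]

/-- `#A[p^∞] = 1 ⇒ A[p^∞]` is finite (bookkeeping for the instance binders of the decomposition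
`Ш(E/K)[p^∞] = Ш(E)[p^∞] ⊕ Ш(E^{d_K})[p^∞]`). [folklore] -/
theorem finite_primaryComponent_of_natCard_eq_one {A : Type*} [AddCommGroup A] (p : ℕ)
    (h : Nat.card (AddCommGroup.primaryComponent A p) = 1) :
    Finite (AddCommGroup.primaryComponent A p) :=
  Nat.finite_of_card_ne_zero (by rw [h]; exact one_ne_zero)

/-! ### §2. The twist side: `Ш(E^{d_K}/ℚ)[p^∞] = 0` from Skinner's Thm. C and a unit `L`-value -/

/-- **The rank-`0` twist at an inert-set field has `p ∤ #Ш(E^{d_K}/ℚ)`** — for a globally minimal `W/ℚ` with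
`ρ̄_{E,p}` onto (`p ≥ 5`), multiplicative at `p`, a (ram) witness, an imaginary quadratic `K` and a set `S ∋ p`
of multiplicative primes `∥ N` INERT in `K` with every other prime of `N` split (the binders of the crux
`ShimuraKolyvaginOrderBoundInertFromFive`, `N = N_E`), NO Tamagawa loss (`p ∤ ord_ℓ Δ_min(E)` for `ℓ ∈ S` and for
the split multiplicative `ℓ ∉ S`), and a globally minimal model `Wd = Cd • W^{(d_K)}` of the twist: IF
`L(E^{d_K},1) ≠ 0` and `ord_p (L(Wd,1)/Ω_{Wd}) ≤ 0` (attested certificate `hLval`), THEN `#Ш(Wd/ℚ)[p^∞] = 1`.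
Mechanism: `Wd` is multiplicative at the inert `p` (`mult_twist_of_jacobiSym`), `Wd[p]` is irreducible
(`hasIrreducibleModPGaloisRep_twist_model`), the (ram) witness passes to `Wd` (inert odd ∕ inert `2` ∕ split
transport), `Ш(Wd)` is finite (GZK, analytic rank `0`), so Skinner's Thm. C gives
`ord_p (L(Wd,1)/Ω) = ord_p #Ш(Wd) + ord_p ∏c(Wd) − 2 ord_p #Wd(ℚ)_tors`; the torsion term vanishes (irreducible)
and `ord_p ∏c(Wd) = 0` by `padicValNat_tamagawaProduct_add_twist_le_of_inertSet'` (its bound is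
`∑_{ℓ∈S} ord_p ord_ℓ Δ_min(E) = 0`); hence `ord_p #Ш(Wd) ≤ 0`. CONDITIONAL on the three displayed published
facts and the certificate; nothing booked. [cite: Skinner2016PacificMC, Thm. C (§1)]
[cite: JetchevSkinnerWan2017, §7.4.2 (p. 31)] [cite: SilvermanAEC2009, VII.5 Prop. 5.1(b) and X.5 Cor. 5.4] -/
theorem natCard_primaryComponent_sha_twist_eq_one_of_certificate
    (hSk : Skinner2016.thmC_padicValRat_bsd_rank_zero)
    (hGZK : rank_eq_analyticRank_of_analyticRank_le_one) (hmod : hasEntireLFunction_rat)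
    (W : WeierstrassCurve ℚ) [W.IsElliptic] [W.IsGloballyMinimal] (p : ℕ) [Fact p.Prime]
    (hp5 : 5 ≤ p) (hsurj : Surj W p) (hmult : Mult W p) (hram : Ram W p)
    {N : ℕ} (hN : W.conductorNorm ℤ = N)
    (K : Type) [Field K] [NumberField K] (hK : IsImaginaryQuadratic K) (S : Finset ℕ)
    (hin : ∀ ℓ ∈ S, ℓ.Prime ∧ ℓ ∣ N ∧ ¬ ℓ ^ 2 ∣ N ∧
      ((Ideal.span {(ℓ : ℤ)}).primesOver (𝓞 K)).ncard = 1 ∧ ¬ (ℓ : ℤ) ∣ NumberField.discr K)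
    (hsp : ∀ ℓ : ℕ, ℓ.Prime → ℓ ∣ N → ℓ ∉ S → ((Ideal.span {(ℓ : ℤ)}).primesOver (𝓞 K)).ncard = 2)
    (hpS : p ∈ S) (hSmult : ∀ ℓ ∈ S, ∃ _ : Fact ℓ.Prime, Mult W ℓ)
    (hSv : ∀ ℓ ∈ S, ¬ p ∣ padicValInt ℓ W.minimalDiscriminantInt)
    (hFC : ∀ (ℓ : ℕ) [Fact ℓ.Prime], ℓ ∉ S → W.HasSplitMultiplicativeReductionAtPrime ℓ →
      ¬ p ∣ padicValInt ℓ W.minimalDiscriminantInt)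
    {Wd : WeierstrassCurve ℚ} [Wd.IsElliptic] [Wd.IsGloballyMinimal] (Cd : VariableChange ℚ)
    (hWd : Cd • W.quadraticTwist (NumberField.discr K : ℚ) = Wd)
    -- the attested analytic certificate for the twist
    (hLt : (W.quadraticTwist (NumberField.discr K : ℚ)).entireLFunction 1 ≠ 0)
    (hLval : ∀ q : ℚ, Wd.entireLFunction 1 / (Wd.realPeriodRat : ℂ) = (q : ℂ) → padicValRat p q ≤ 0) :
    Nat.card (AddCommGroup.primaryComponent Wd.sha p) = 1 := by
  have hp : p.Prime := Fact.out
  have hp2 : p ≠ 2 := by omega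
  have hp3 : 3 ≤ p := by omega
  have h2 : Module.finrank ℚ K = 2 := hK.1
  have hirr : W.HasIrreducibleModPGaloisRep p :=
    hasIrreducibleModPGaloisRep_of_hasSurjectiveModNGaloisRep W p hsurj
  have hD0 : (NumberField.discr K : ℚ) ≠ 0 := by exact_mod_cast NumberField.discr_ne_zero K
  haveI hEt : (W.quadraticTwist (NumberField.discr K : ℚ)).IsElliptic := W.isElliptic_quadraticTwist hD0
  -- `p` is INERT in `K`
  obtain ⟨-, -, -, hnp, hdp⟩ := hin p hpS
  have hJp : jacobiSym (NumberField.discr K) p = -1 :=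
    jacobiSym_discr_eq_neg_one_of_ncard_ne_two h2 hp hp2 (by rw [hnp]; decide) hdp
  -- the inert set in Jacobi-symbol form, the other bad primes split in local form
  have hSin : ∀ ℓ ∈ S, ∃ _ : Fact ℓ.Prime, Mult W ℓ ∧
      ((ℓ ≠ 2 ∧ jacobiSym (NumberField.discr K) ℓ = -1) ∨ (ℓ = 2 ∧ NumberField.discr K % 8 = 5)) := by
    intro ℓ hℓ
    obtain ⟨hℓF, hm⟩ := hSmult ℓ hℓ
    obtain ⟨-, -, -, hn, hd⟩ := hin ℓ hℓ
    refine ⟨hℓF, hm, ?_⟩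
    have hn' : ((Ideal.span {(ℓ : ℤ)}).primesOver (𝓞 K)).ncard ≠ 2 := by rw [hn]; decide
    by_cases hℓ2 : ℓ = 2
    · subst hℓ2
      have hn2 : ((Ideal.span {(2 : ℤ)}).primesOver (𝓞 K)).ncard ≠ 2 := by
        simpa only [Nat.cast_ofNat] using hn'
      have hd2 : ¬ (2 : ℤ) ∣ NumberField.discr K := by simpa only [Nat.cast_ofNat] using hd
      exact Or.inr ⟨rfl, discr_emod_eight_eq_five_of_ncard_ne_two h2 hn2 hd2⟩
    · exact Or.inl ⟨hℓ2, jacobiSym_discr_eq_neg_one_of_ncard_ne_two h2 hℓF.out hℓ2 hn' hd⟩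
  have hsplit : ∀ (ℓ : ℕ) [Fact ℓ.Prime], ¬ W.HasGoodReductionAtPrime ℓ → ℓ ∉ S →
      IsSquare (algebraMap ℚ ℚ_[ℓ] (NumberField.discr K : ℚ)) := by
    intro ℓ hℓF hg hℓS
    have hℓN : ℓ ∣ W.conductorNorm ℤ := (W.dvd_conductorNorm_iff_not_hasGoodReductionAtPrime ℓ).mpr hg
    rw [hN] at hℓN
    exact isSquare_discr_padic_of_ncard_eq_two h2 ℓ (hsp ℓ hℓF.out hℓN hℓS)
  -- the twist: irreducible, `p ∤ #tors`, multiplicative at `p`, (ram)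
  have hirrd : Wd.HasIrreducibleModPGaloisRep p := hasIrreducibleModPGaloisRep_twist_model W p K h2 hirr Cd hWd
  have htd : ¬ p ∣ Wd.torsionOrder := not_dvd_torsionOrder_of_irr Wd p hirrd
  have hmultd : Wd.HasMultiplicativeReductionAtPrime p := mult_twist_of_jacobiSym W K Cd hWd p hp2 hJp hmult
  have hramd : Ram Wd p := by
    obtain ⟨ℓ₀, hℓ₀F, hℓ₀p, hmult₀, hram₀⟩ := hram
    by_cases h0S : ℓ₀ ∈ S
    · obtain ⟨_, -, hcase⟩ := hSin ℓ₀ h0S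
      rcases hcase with ⟨h02, hJ0⟩ | ⟨h0eq, h8⟩
      · exact ram_twist_of_inert_witness W K Cd hWd ℓ₀ h02 hJ0 p hℓ₀p hmult₀ hram₀
      · subst h0eq
        exact ram_twist_of_inert_witness_two W K Cd hWd h8 p hℓ₀p hmult₀ hram₀
    · have hsq₀ : IsSquare (algebraMap ℚ ℚ_[ℓ₀] (NumberField.discr K : ℚ)) :=
        hsplit ℓ₀ (WeierstrassCurve.HasMultiplicativeReduction.not_hasGoodReduction (R := ℤ_[ℓ₀]) hmult₀) h0S
      refine ⟨ℓ₀, inferInstance, hℓ₀p, ?_, ?_⟩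
      · rw [← hWd, hasMultiplicativeReductionAtPrime_smul_iff]
        exact (hasMultiplicativeReductionAtPrime_quadraticTwist_iff W hD0 hsq₀).mpr hmult₀
      · rwa [padicValInt_minimalDiscriminantInt_twist_eq W ℓ₀ hD0 hsq₀ Cd hWd]
  -- no Tamagawa loss: `ord_p ∏c(Wd) = 0`
  have hT := padicValNat_tamagawaProduct_add_twist_le_of_inertSet' W p hp5 K Cd hWd S hSin
    (fun ℓ _ hg hℓS ↦ hsplit ℓ hg hℓS) (fun ℓ _ hℓS hs ↦ hFC ℓ hℓS hs)
  have hsum : ∑ ℓ ∈ S, padicValNat p (padicValInt ℓ W.minimalDiscriminantInt) = 0 :=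
    Finset.sum_eq_zero fun ℓ hℓ ↦ padicValNat.eq_zero_of_not_dvd (hSv ℓ hℓ)
  have htam : padicValNat p Wd.tamagawaProduct = 0 := by omega
  have htor : padicValNat p Wd.torsionOrder = 0 := padicValNat.eq_zero_of_not_dvd htd
  -- central value and finiteness of `Ш(Wd)`
  have hLt' : (W.quadraticTwist (NumberField.discr K : ℚ)).entireLFunction = Wd.entireLFunction := by
    rw [← hWd, entireLFunction_smul]
  have hLd1 : Wd.entireLFunction 1 ≠ 0 := by rw [← hLt']; exact hLt
  have hfinSd : Wd.ShaFinite := (hGZK Wd (by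
    rw [(Wd.analyticRank_eq_zero_iff_holds (hmod Wd)).2 hLd1]; omega)).2
  -- Skinner's Thm. C and the certificate
  obtain ⟨qS, hqS, hvqS⟩ := hSk Wd p hp3 (Or.inr hmultd) hirrd hramd hLd1 hfinSd
  have hq0 := hLval qS hqS
  have hsha0 : padicValNat p Wd.shaOrder = 0 := by
    rw [htam, htor, Nat.cast_zero, mul_zero, add_zero, sub_zero] at hvqS
    have : (padicValNat p Wd.shaOrder : ℤ) ≤ 0 := hvqS ▸ hq0
    omega
  haveI : Finite Wd.sha := hfinSd
  rw [card_addPrimaryComponent_eq_pow, Nat.factorization_def _ hp]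
  change p ^ padicValNat p Wd.shaOrder = 1
  rw [hsha0, pow_zero]

/-- **`Ш(E/K)[p^∞] = 0` at an inert-set field from the two classical certificates.** Same binders; (i) is the
hypothesis `hSha : Ш(E/ℚ)[p] = 0` (supplier: `noPTorsion_sha_of_kolyvaginIndexCertificate` below, or any
`p`-descent), (ii) the twist certificate quantified over the globally minimal models of `E^{(d_K)}` (a minimal
model exists: `hasGlobalMinimalModel_rat_holds`; the value `L(Wd,1)/Ω_{Wd}` does not depend on the choice).
Then `#Ш(E⊗K/K)[p^∞] = #Ш(E/ℚ)[p^∞] · #Ш(E^{d_K}/ℚ)[p^∞] = 1` (`p` odd;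
`card_primaryComponent_sha_baseChange_quadratic_of_odd_of_finite`). CONDITIONAL; nothing booked.
[cite: JetchevSkinnerWan2017, §7.4.1 (p. 30)] [cite: Skinner2016PacificMC, Thm. C (§1)] -/
theorem natCard_primaryComponent_sha_baseChange_eq_one_of_certificates
    (hSk : Skinner2016.thmC_padicValRat_bsd_rank_zero)
    (hGZK : rank_eq_analyticRank_of_analyticRank_le_one) (hmod : hasEntireLFunction_rat)
    (W : WeierstrassCurve ℚ) [W.IsElliptic] [W.IsGloballyMinimal] (p : ℕ) [Fact p.Prime]
    (hp5 : 5 ≤ p) (hsurj : Surj W p) (hmult : Mult W p) (hram : Ram W p)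
    {N : ℕ} (hN : W.conductorNorm ℤ = N)
    (K : Type) [Field K] [NumberField K] (hK : IsImaginaryQuadratic K) (S : Finset ℕ)
    (hin : ∀ ℓ ∈ S, ℓ.Prime ∧ ℓ ∣ N ∧ ¬ ℓ ^ 2 ∣ N ∧
      ((Ideal.span {(ℓ : ℤ)}).primesOver (𝓞 K)).ncard = 1 ∧ ¬ (ℓ : ℤ) ∣ NumberField.discr K)
    (hsp : ∀ ℓ : ℕ, ℓ.Prime → ℓ ∣ N → ℓ ∉ S → ((Ideal.span {(ℓ : ℤ)}).primesOver (𝓞 K)).ncard = 2)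
    (hpS : p ∈ S) (hSmult : ∀ ℓ ∈ S, ∃ _ : Fact ℓ.Prime, Mult W ℓ)
    (hSv : ∀ ℓ ∈ S, ¬ p ∣ padicValInt ℓ W.minimalDiscriminantInt)
    (hFC : ∀ (ℓ : ℕ) [Fact ℓ.Prime], ℓ ∉ S → W.HasSplitMultiplicativeReductionAtPrime ℓ →
      ¬ p ∣ padicValInt ℓ W.minimalDiscriminantInt)
    -- certificate (i): no `p`-torsion in `Ш(E/ℚ)`
    (hSha : ∀ x : W.sha, (p : ℤ) • x = 0 → x = 0)
    -- certificate (ii): the twist's central value, on every globally minimal model of `E^{(d_K)}`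
    (hLt : (W.quadraticTwist (NumberField.discr K : ℚ)).entireLFunction 1 ≠ 0)
    (hLval : ∀ (Wd : WeierstrassCurve ℚ) [Wd.IsElliptic] [Wd.IsGloballyMinimal] (Cd : VariableChange ℚ),
      Cd • W.quadraticTwist (NumberField.discr K : ℚ) = Wd →
      ∀ q : ℚ, Wd.entireLFunction 1 / (Wd.realPeriodRat : ℂ) = (q : ℂ) → padicValRat p q ≤ 0) :
    Nat.card (AddCommGroup.primaryComponent (W.baseChange K).sha p) = 1 := by
  have hp : p.Prime := Fact.out
  have hp2 : p ≠ 2 := by omega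
  have h2 : Module.finrank ℚ K = 2 := hK.1
  have hD0 : (NumberField.discr K : ℚ) ≠ 0 := by exact_mod_cast NumberField.discr_ne_zero K
  haveI hEt : (W.quadraticTwist (NumberField.discr K : ℚ)).IsElliptic := W.isElliptic_quadraticTwist hD0
  obtain ⟨Cd, hCd⟩ := hasGlobalMinimalModel_rat_holds (W.quadraticTwist (NumberField.discr K : ℚ))
  haveI : (Cd • W.quadraticTwist (NumberField.discr K : ℚ)).IsGloballyMinimal := hCd
  set Wd : WeierstrassCurve ℚ := Cd • W.quadraticTwist (NumberField.discr K : ℚ) with hWd_def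
  have hWd : Cd • W.quadraticTwist (NumberField.discr K : ℚ) = Wd := rfl
  have hd1 : Nat.card (AddCommGroup.primaryComponent Wd.sha p) = 1 :=
    natCard_primaryComponent_sha_twist_eq_one_of_certificate hSk hGZK hmod W p hp5 hsurj hmult hram hN K hK S
      hin hsp hpS hSmult hSv hFC Cd hWd hLt (hLval Wd Cd hWd)
  have hW1 : Nat.card (AddCommGroup.primaryComponent W.sha p) = 1 :=
    natCard_primaryComponent_eq_one_of_noPTorsion p hSha
  haveI := finite_primaryComponent_of_natCard_eq_one p hd1
  haveI := finite_primaryComponent_of_natCard_eq_one p hW1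
  haveI hEK : (W.baseChange K).IsElliptic := by rw [WeierstrassCurve.baseChange]; infer_instance
  rw [card_primaryComponent_sha_baseChange_quadratic_of_odd_of_finite W K h2 Wd ⟨Cd, hWd⟩ (W.baseChange K)
    ⟨1, one_smul _ _⟩ p hp2, hW1, hd1]

/-! ### §3. The slice's conclusion at such a datum; the classical supplier of certificate (i) -/

/-- **The conclusion of `ShimuraKolyvaginOrderBoundInertFromFive` at a certificate datum.** With the binders of
`natCard_primaryComponent_sha_baseChange_eq_one_of_certificates`, the slice's trailing clause holds for EVERY
point `P ∈ E(K)` (displayed or not, torsion or not): `#Ш(E/K)[p^∞] = 1 ≤ p^{2·ord_p[E(K):ℤP]}`. This is what a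
certificate row of the slice amounts to; it says nothing about the Kolyvagin system on `X_{N⁺,N⁻}`.
CONDITIONAL; nothing booked. [cite: Kim2022HigherGZ, §2.1 and Thm. 4.3 (the slice's printed statement)]
[cite: Skinner2016PacificMC, Thm. C (§1)] [cite: JetchevSkinnerWan2017, §7.4.1 (p. 30)] -/
theorem shimuraKolyvaginOrderBoundInert_at_of_certificates
    (hSk : Skinner2016.thmC_padicValRat_bsd_rank_zero)
    (hGZK : rank_eq_analyticRank_of_analyticRank_le_one) (hmod : hasEntireLFunction_rat)
    (W : WeierstrassCurve ℚ) [W.IsElliptic] [W.IsGloballyMinimal] (p : ℕ) [Fact p.Prime]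
    (hp5 : 5 ≤ p) (hsurj : Surj W p) (hmult : Mult W p) (hram : Ram W p)
    {N : ℕ} (hN : W.conductorNorm ℤ = N)
    (K : Type) [Field K] [NumberField K] (hK : IsImaginaryQuadratic K) (S : Finset ℕ)
    (hin : ∀ ℓ ∈ S, ℓ.Prime ∧ ℓ ∣ N ∧ ¬ ℓ ^ 2 ∣ N ∧
      ((Ideal.span {(ℓ : ℤ)}).primesOver (𝓞 K)).ncard = 1 ∧ ¬ (ℓ : ℤ) ∣ NumberField.discr K)
    (hsp : ∀ ℓ : ℕ, ℓ.Prime → ℓ ∣ N → ℓ ∉ S → ((Ideal.span {(ℓ : ℤ)}).primesOver (𝓞 K)).ncard = 2)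
    (hpS : p ∈ S) (hSmult : ∀ ℓ ∈ S, ∃ _ : Fact ℓ.Prime, Mult W ℓ)
    (hSv : ∀ ℓ ∈ S, ¬ p ∣ padicValInt ℓ W.minimalDiscriminantInt)
    (hFC : ∀ (ℓ : ℕ) [Fact ℓ.Prime], ℓ ∉ S → W.HasSplitMultiplicativeReductionAtPrime ℓ →
      ¬ p ∣ padicValInt ℓ W.minimalDiscriminantInt)
    (hSha : ∀ x : W.sha, (p : ℤ) • x = 0 → x = 0)
    (hLt : (W.quadraticTwist (NumberField.discr K : ℚ)).entireLFunction 1 ≠ 0)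
    (hLval : ∀ (Wd : WeierstrassCurve ℚ) [Wd.IsElliptic] [Wd.IsGloballyMinimal] (Cd : VariableChange ℚ),
      Cd • W.quadraticTwist (NumberField.discr K : ℚ) = Wd →
      ∀ q : ℚ, Wd.entireLFunction 1 / (Wd.realPeriodRat : ℂ) = (q : ℂ) → padicValRat p q ≤ 0)
    (P : (W.baseChange K).toAffine.Point) :
    Nat.card (AddCommGroup.primaryComponent (W.baseChange K).sha p) ≤
      p ^ (2 * padicValNat p (AddSubgroup.zmultiples P).index) := by
  rw [natCard_primaryComponent_sha_baseChange_eq_one_of_certificates hSk hGZK hmod W p hp5 hsurj hmult hram hN K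
    hK S hin hsp hpS hSmult hSv hFC hSha hLt hLval]
  exact Nat.one_le_pow _ _ (Fact.out : p.Prime).pos

/-- **Certificate (i) from Kolyvagin's CLASSICAL index certificate** (the form consumed by the rung): for the
route's `∀ N W K` published inputs `kolyvagin` (finiteness of `Ш(E/K₁)`) and
`Kolyvagin1990_padicValNat_card_sha_le` (McCallum 1991 §1: `ord_p #Ш(E/K₁) ≤ 2·ord_p[E(K₁):ℤy_{K₁}]`, `ρ̄_{E,p}`
onto, `p` odd), an auxiliary imaginary quadratic `K₁` with the Heegner hypothesis for the level `N`, a Heegner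
point `y ∈ E(K₁)` of infinite order and `p ∤ [E(K₁):ℤy]` give `Ш(E/ℚ)[p] = 0` — the tree theorem
`Typed.noPTorsion_of_kolyvagin_of_not_dvd_index` (restriction `Ш(E/ℚ) → Ш(E/K₁)` injective on `p`-torsion).
Per curve; the triple (`K₁`, `y`, `p ∤ I_{K₁}`) is an ATTESTED computation. [cite: McCallumLMS1991, §1 Theorem (Kolyvagin), p. 296]
[cite: GrossLMS1991, §2 Prop. 2.1 (2)] -/
theorem noPTorsion_sha_of_kolyvaginIndexCertificate
    (hKo : ∀ (N : ℕ) [NeZero N] (W : WeierstrassCurve ℚ) (K : Type) [Field K] [NumberField K],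
      kolyvagin N W K)
    (hB : ∀ (N : ℕ) [NeZero N] (W : WeierstrassCurve ℚ) (K : Type) [Field K] [NumberField K],
      Kolyvagin1990_padicValNat_card_sha_le N W K)
    (W : WeierstrassCurve ℚ) [W.IsElliptic] (p : ℕ) [Fact p.Prime] (hp2 : p ≠ 2) (hsurj : Surj W p)
    (N : ℕ) [NeZero N] (K₁ : Type) [Field K₁] [NumberField K₁] (hK₁ : IsImaginaryQuadratic K₁)
    (hH₁ : SatisfiesHeegnerHypothesis N K₁) {y : (W.baseChange K₁).toAffine.Point}
    (hy : IsHeegnerPoint N W K₁ y) (hynt : ¬ IsOfFinAddOrder y) (hI : ¬ p ∣ (AddSubgroup.zmultiples y).index) :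
    ∀ x : W.sha, (p : ℤ) • x = 0 → x = 0 :=
  noPTorsion_of_kolyvagin_of_not_dvd_index W p (hKo N W K₁) (hB N W K₁) hK₁ hH₁ hy hynt hp2 hsurj hI

end Summit.BirchSwinnertonDyer.BirchSwinnertonDyer.Theorems

end
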